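import Summits.CriticalPhenomena.PercolationContinuityZ3.Theorems.Transplant.Bcc111ClawTable
import HarnessLib

/-!
# The bcc (111)-films `F_m(bcc)`, exit-form routing certificate II′: a FASTER EVALUATION ORDER for the kernel (pockets exist only for `s_R = 0`)

builds on p205010 (kernel theorem, internal audit signed; external expert review pending) — NOT used in this file.
Lane `prim-bschramm`, seat `prim-bschramm-p2` (gen 48; class C1b, METHOD = input substitution; memo `HOME/bschramm/P2-LATTICES.md` §159); helper file
(`--supports stmt-CriticalPhenomena-4575 --as helper`).  In the kernel family `t_R = t_D = 3` the rerouting block has R-POCKETS only when `s_R = 0`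
(`isPocket_three_eq_false`, a finite check); the model's `inRB` / `inDB` / `rem0` / `remM` re-test the pocket condition (six neighbour blocks) at every
column.  This file defines copies `…F` of the model's tests and of the rule `clawH` that skip the pocket test unless `s_R = 0`, proves them EQUAL to the
originals on the kernel family (`clawHF_eq`, `clawHOKL_iff_fast`), and so lets «Bcc111ClawTableOK*» run the kernel on the cheaper copies while concluding
the model's `ClawHOK`.  Nothing here changes the mathematics.
[cite: DuminilCopinSidoraviciusTassion2016, §2.3 (proof of Fact 2)]
-/

namespace Summit.CriticalPhenomena.PercolationContinuityZ3.Theorems.Transplant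

namespace Bcc111Claw

open BccClawX (Pt)

/-! ## §1 No pockets unless `s_R = 0` -/

/-- A point of hexagonal norm `≤ 3` has both coordinates in `[−3, 3]`. [folklore] -/
theorem abs_le_of_tnZ_le {p : Pt} (h : tnZ p ≤ 3) : -3 ≤ p.1 ∧ p.1 ≤ 3 ∧ -3 ≤ p.2 ∧ p.2 ≤ 3 := by
  have h1 : |p.1| ≤ 3 := (le_max_left _ _).trans h
  have h2 : |p.2| ≤ 3 := ((le_max_left _ _).trans (le_max_right _ _)).trans h
  rw [abs_le] at h1 h2
  exact ⟨h1.1, h1.2, h2.1, h2.2⟩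

/-- **In the kernel family `t_R = 3` the rerouting block has pockets only for `s_R = 0`** (finite check over the `49` lattice points of the box).
[folklore] -/
theorem isPocket_three_eq_false {sR : ℕ} (h0 : sR ≠ 0) (h3 : sR ≤ 3) (p : Pt) : isPocket 3 sR p = false := by
  by_cases hb : tnZ p ≤ 3
  · obtain ⟨a1, a2, b1, b2⟩ := abs_le_of_tnZ_le hb
    obtain ⟨x, y⟩ := p
    simp only at a1 a2 b1 b2
    have hs : sR = 1 ∨ sR = 2 ∨ sR = 3 := by omega
    rcases hs with rfl | rfl | rfl <;> interval_cases x <;> interval_cases y <;> decide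
  · simp [isPocket, inBlk, hb]

/-! ## §2 The fast copies and their equality with the model on the kernel family -/

/-- Pocket test, skipped unless `s_R = 0` or `t_R ≠ 3`. [folklore] -/
def isPocketF (tR sR : ℕ) (p : Pt) : Bool := (sR == 0 || !(tR == 3)) && isPocket tR sR p

/-- `isPocketF = isPocket` on the kernel family. [folklore] -/
theorem isPocketF_eq {tR sR : ℕ} (htR : tR = 3) (hsR : sR ≤ 3) : isPocketF tR sR = isPocket tR sR := by
  funext p
  unfold isPocketF
  by_cases h0 : sR = 0
  · simp [h0]
  · subst htR; rw [isPocket_three_eq_false h0 hsR]; simp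

/-- Fast `inRB`. [folklore] -/
def inRBF (tR sR : ℕ) (p : Pt) : Bool := inBlk tR sR p && !isPocketF tR sR p

/-- Fast `inDB`. [folklore] -/
def inDBF (tR tD sR sD : ℕ) (p : Pt) : Bool := inBlk tD sD p && !isPocketF tR sR p

/-- Fast `rem0`. [folklore] -/
def rem0F (tR sR : ℕ) (p : Pt) : Bool :=
  inRBF tR sR p && decide (2 ≤ tnZ p) && decide (nbrCount (inRBF tR sR) p [(1, 0), (-1, 1), (0, -1)] ≤ 1)

/-- Fast `remM`. [folklore] -/
def remMF (tR sR : ℕ) (p : Pt) : Bool :=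
  inRBF tR sR p && decide (2 ≤ tnZ p) && decide (nbrCount (inRBF tR sR) p [(-1, 0), (1, -1), (0, 1)] ≤ 1)

/-- Fast `remAny`. [folklore] -/
def remAnyF (tR sR : ℕ) (p : Pt) : Bool := rem0F tR sR p || remMF tR sR p

/-- Fast `certE`. [folklore] -/
def certEF (tR tD sR sD : ℕ) (a : Pt) : Bool :=
  inRBF tR sR a && !(a == (0, 0)) &&
    (remAnyF tR sR a || dirs.any fun d => !inDBF tR tD sR sD (a.1 + d.1, a.2 + d.2) || remAnyF tR sR (a.1 + d.1, a.2 + d.2))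

/-- Fast `certW`. [folklore] -/
def certWF (tR tD sR sD : ℕ) (a b c : Pt) : Bool :=
  inDBF tR tD sR sD c && !(c == (0, 0)) && !(c == a) && !(c == b) &&
    (remAnyF tR sR c || dirs.any fun d =>
      let p : Pt := (c.1 + d.1, c.2 + d.2)
      !(p == (0, 0)) && !(p == a) && !(p == b) && (!inDBF tR tD sR sD p || remAnyF tR sR p))

/-- Fast `penLo`. [folklore] -/
def penLoF (tR sR : ℕ) (a : Pt) (τ : ℕ) (p : Pt) : Bool :=
  decide (2 ≤ τ) || [(1, 0), (-1, 1), (0, -1)].any (fun u => p == (a.1 + u.1, a.2 + u.2)) ||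
    ((τ == 1) && [(1, 0), (-1, 1), (0, -1)].any (fun u => p == (a.1 - u.1, a.2 - u.2)) && !rem0F tR sR p)

/-- Fast `penHi`. [folklore] -/
def penHiF (tR sR : ℕ) (a : Pt) (τ : ℕ) (p : Pt) : Bool :=
  decide (2 ≤ τ) || [(1, 0), (-1, 1), (0, -1)].any (fun u => p == (a.1 - u.1, a.2 - u.2)) ||
    ((τ == 1) && [(1, 0), (-1, 1), (0, -1)].any (fun u => p == (a.1 + u.1, a.2 + u.2)) && !remMF tR sR p)

/-- Fast `tyOK`. [folklore] -/
def tyOKF (tR sR : ℕ) (a1 a2 : Pt) (ty : ℕ) : Bool :=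
  if a1 == a2 then decide (ty ≤ 8) && (!(ty / 3 == 0) || !rem0F tR sR a1) && (!(ty % 3 == 0) || !remMF tR sR a1) else ty == 9

/-- Fast `clawH` (the same first-fit rule over the fast tests). [folklore] -/
def clawHF (tR tD sR sD : ℕ) (a1 a2 a3 : Pt) (ty : ℕ) : Option (Pt × ℕ × Bool × ℕ × ℕ × ℕ × List Pt × List Pt × List Pt) :=
  let same : Bool := a1 == a2
  hubs.findSome? fun ⟨Q, i, up⟩ =>
    let ⟨bc, F0, F1, X0, X1⟩ := hubCols Q i up
    if !inRBF tR sR Q || !decide (tnZ Q ≤ 2) || Q == a1 || Q == a2 || Q == a3 || (up && rem0F tR sR Q) || (!up && remMF tR sR Q) ||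
        !inRBF tR sR bc || bc == a1 || bc == a2 || bc == a3 then none
    else
      assigns.findSome? fun ⟨j, k, xi⟩ =>
        let ⟨s1, s2, s3⟩ := starts F0 F1 X0 X1 j k xi
        let av1 : List Pt := if same then [Q, bc, a3] else [Q, bc, a2, a3]
        let av2 : List Pt := if same then [Q, bc, a3] else [Q, bc, a1, a3]
        let L1 := ((cand (a1.1 - s1.1, a1.2 - s1.2)).map (shiftTo s1)).filter fun l =>
          legOK (inRBF tR sR) av1 s1 a1 l && (!same || penLoF tR sR a1 (ty / 3) (penult l))
        let L2 := ((cand (a2.1 - s2.1, a2.2 - s2.2)).map (shiftTo s2)).filter fun l =>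
          legOK (inRBF tR sR) av2 s2 a2 l && (!same || penHiF tR sR a1 (ty % 3) (penult l))
        let L3 := ((cand (a3.1 - s3.1, a3.2 - s3.2)).map (shiftTo s3)).filter fun l => legOK (inDBF tR tD sR sD) [Q, bc, a1, a2] s3 a3 l
        L1.findSome? fun l1 => L2.findSome? fun l2 =>
          if !disjH same a1 l1 l2 then none
          else (L3.find? fun l3 => disjH false a1 l3 l1 && disjH false a1 l3 l2).map fun l3 => (Q, i, up, j, k, xi, l1, l2, l3)

/-- Fast `ClawHOKL`. [folklore] -/
def ClawHOKLF (sR sD : ℕ) (L : List Pt) : Prop :=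
  ∀ a1 ∈ L, certEF 3 3 sR sD a1 = true → ∀ a2 ∈ hexPts, certEF 3 3 sR sD a2 = true → ∀ a3 ∈ hexPts, certWF 3 3 sR sD a1 a2 a3 = true →
    ∀ ty ∈ List.range 10, tyOKF 3 sR a1 a2 ty = true → (clawHF 3 3 sR sD a1 a2 a3 ty).isSome = true

section Eq

variable {tR tD sR sD : ℕ} (htR : tR = 3) (hsR : sR ≤ 3)
include htR hsR

/-- `inRBF = inRB` on the kernel family. [folklore] -/
theorem inRBF_eq : inRBF tR sR = inRB tR sR := by funext p; rw [inRBF, inRB, isPocketF_eq htR hsR]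

/-- `inDBF = inDB` on the kernel family. [folklore] -/
theorem inDBF_eq : inDBF tR tD sR sD = inDB tR tD sR sD := by funext p; rw [inDBF, inDB, isPocketF_eq htR hsR]

/-- `rem0F = rem0` on the kernel family. [folklore] -/
theorem rem0F_eq : rem0F tR sR = rem0 tR sR := by funext p; rw [rem0F, rem0, inRBF_eq htR hsR]

/-- `remMF = remM` on the kernel family. [folklore] -/
theorem remMF_eq : remMF tR sR = remM tR sR := by funext p; rw [remMF, remM, inRBF_eq htR hsR]

/-- `remAnyF = remAny` on the kernel family. [folklore] -/
theorem remAnyF_eq : remAnyF tR sR = remAny tR sR := by funext p; rw [remAnyF, remAny, rem0F_eq htR hsR, remMF_eq htR hsR]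

/-- `certEF = certE` on the kernel family. [folklore] -/
theorem certEF_eq : certEF tR tD sR sD = certE tR tD sR sD := by
  funext p; rw [certEF, certE, inRBF_eq htR hsR, inDBF_eq htR hsR, remAnyF_eq htR hsR]

/-- `certWF = certW` on the kernel family. [folklore] -/
theorem certWF_eq : certWF tR tD sR sD = certW tR tD sR sD := by
  funext a b c; rw [certWF, certW, inDBF_eq htR hsR, remAnyF_eq htR hsR]

/-- `penLoF = penLo` on the kernel family. [folklore] -/
theorem penLoF_eq : penLoF tR sR = penLo tR sR := by funext a τ p; rw [penLoF, penLo, rem0F_eq htR hsR]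

/-- `penHiF = penHi` on the kernel family. [folklore] -/
theorem penHiF_eq : penHiF tR sR = penHi tR sR := by funext a τ p; rw [penHiF, penHi, remMF_eq htR hsR]

/-- `tyOKF = tyOK` on the kernel family. [folklore] -/
theorem tyOKF_eq : tyOKF tR sR = tyOK tR sR := by funext a1 a2 ty; rw [tyOKF, tyOK, rem0F_eq htR hsR, remMF_eq htR hsR]

/-- `clawHF = clawH` on the kernel family. [folklore] -/
theorem clawHF_eq : clawHF tR tD sR sD = clawH tR tD sR sD := by
  funext a1 a2 a3 ty
  rw [clawHF, clawH, inRBF_eq htR hsR, inDBF_eq htR hsR, rem0F_eq htR hsR, remMF_eq htR hsR, penLoF_eq htR hsR, penHiF_eq htR hsR]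

end Eq

/-- **The fast statement is the model's statement** (kernel family `t_R = t_D = 3`, `s_R ≤ 3`). [folklore] -/
theorem clawHOKL_iff_fast {sR sD : ℕ} (hsR : sR ≤ 3) (L : List Pt) : ClawHOKLF sR sD L ↔ ClawHOKL sR sD L := by
  unfold ClawHOKLF ClawHOKL
  rw [certEF_eq rfl hsR, certWF_eq rfl hsR, tyOKF_eq rfl hsR, clawHF_eq rfl hsR]

end Bcc111Claw

end Summit.CriticalPhenomena.PercolationContinuityZ3.Theorems.Transplant
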